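import Mathlib
import HarnessLib
import Summits.AtomisticToContinuum.BoseEinsteinCondensation.Theorems.NumberPhaseSandwichSatNearPivot
import Summits.AtomisticToContinuum.BoseEinsteinCondensation.Theorems.NumberPhaseSandwichHardCoreRung

/-! # NumberPhaseSandwich · near-pivot SATURATION for hard-core bosons (v-pointwise corollary)

Route NumberPhaseSandwich, deciding crux PhaseSaturation (stmt-AtomisticToContinuum-32637), line «second-moment-near-pivot»:
the landed conversion `stub_satNearPivot_of_secondMoment : PairSecondMomentP → StubNearPivot` (p775386) is typed on the
`∀ v` statements; this file states and proves its v-POINTWISE instance for potentials with a genuine hard core, feeding in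
the hard-core second-moment bound `NumberPhaseSandwichHardCoreRung.pairSecondMomentP_of_hardCore`: for every finite-range
`v` with `v = ⊤` on `[0,a)` the near-pivot saturation law `(n_c − n_c')·Var ≤ C(ρ,m)(n_c + n_c')` holds at every fixed
depth below the pivot — i.e. the NEAR-PIVOT HALF of PhaseSaturation is a theorem in a regime where BEC is open (T3 witness
made explicit, as crit-1 asked, l.647). Proof = the landed proof with `h v hv` replaced by the hard-core instance. 0 sorry. -/

noncomputable section

namespace Summit.AtomisticToContinuum.BoseEinsteinCondensation.Theorems.NumberPhaseSandwichHardCoreSat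

open Literature.MathematicalPhysics.QuantumManyBody.BoseGas MeasureTheory Set Filter
open Summit.AtomisticToContinuum.BoseEinsteinCondensation.Theorems.NumberPhaseSandwichSatNearPivot
open scoped ENNReal NNReal

/-- **Near-pivot saturation for hard cores**: the body of `StubNearPivot` (crux PhaseSaturation, stub A) at any
finite-range `v` with a genuine hard core. -/
theorem satNearPivot_of_hardCore {a : ℝ} (ha : 0 < a) {v : ℝ → ℝ≥0∞} (hv : IsRepulsiveFiniteRange v)
    (hcore : ∀ r, r < a → v r = ⊤) :
    ∃ ρ₀ : ℝ, 0 < ρ₀ ∧ ∀ ρ : ℝ, 0 < ρ → ρ < ρ₀ →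
    ∀ m : ℕ, ∃ C : ℝ, 0 < C ∧ ∃ c₀ : ℝ, 0 < c₀ ∧ ∀ᶠ N : ℕ in Filter.atTop, ∃ δ : ENNReal, 0 < δ ∧
      ∀ Ψ : TrialState N (sideLength ρ N), energy v Ψ ≤ groundStateEnergy v N (sideLength ρ N) + δ →
        ENNReal.ofReal (c₀ * N) ≤ maxOccupation N Ψ.ψ ∨
          ∀ K k : ℕ, 1 / Real.sqrt ρ ≤ sideLength ρ N / 2 ^ K → sideLength ρ N / 2 ^ K < 2 * (1 / Real.sqrt ρ) →
            1 ≤ k → k ≤ K → K ≤ k + m →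
            ∀ c c' : SubIdx (2 ^ k), c ≠ c' → Sib c c' → IntP k c →
              dip ρ N k c c' Ψ.ψ * Var ρ N k c c' Ψ.ψ ≤ ENNReal.ofReal C * (occ ρ N k c Ψ.ψ + occ ρ N k c' Ψ.ψ) := by
  obtain ⟨ρ₀, hρ₀, H⟩ := NumberPhaseSandwichHardCoreRung.pairSecondMomentP_of_hardCore ha hv hcore
  refine ⟨ρ₀, hρ₀, fun ρ hρ hρlt m => ?_⟩
  obtain ⟨C, hC, c₀, hc₀, hev⟩ := H ρ hρ hρlt m
  refine ⟨2 * (C * (2 ^ (6 * (m + 1)) / ρ)), by positivity, c₀, hc₀, ?_⟩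
  filter_upwards [hev] with N hN
  obtain ⟨δ, hδ, hΨ⟩ := hN
  refine ⟨δ, hδ, fun Ψ hE => ?_⟩
  rcases hΨ Ψ hE with hesc | hmom
  · exact Or.inl hesc
  refine Or.inr fun K k hK1 hK2 hk1 hkK hKkm c c' hne hsib hint => ?_
  have hsq : 0 < Real.sqrt ρ := Real.sqrt_pos.2 hρ
  have hLK : 0 < sideLength ρ N / 2 ^ K := lt_of_lt_of_le (by positivity) hK1
  have hL : 0 < sideLength ρ N := by
    have h2K : (0 : ℝ) < 2 ^ K := by positivity
    have := mul_pos hLK h2K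
    rwa [div_mul_cancel₀ _ h2K.ne'] at this
  have hℓ : 0 < sideLength ρ N / 2 ^ k := by positivity
  have h1 : dip ρ N k c c' Ψ.ψ ≤ 2 * (occ ρ N k c Ψ.ψ + occ ρ N k c' Ψ.ψ) :=
    NumberPhaseSandwichLossBookkeeping.dip_le_two_mul hℓ c c' Ψ
  have h2 : Var ρ N k c c' Ψ.ψ ≤ ENNReal.ofReal (C * (2 ^ (6 * (m + 1)) / ρ)) := by
    refine (Var_le_secondMoment hℓ c c' Ψ.ψ).trans ((hmom K k hK1 hK2 hk1 hkK hKkm c c' hne hsib hint).trans ?_)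
    apply ENNReal.ofReal_le_ofReal
    have hw := window_bound hρ hL.le hK2 hKkm
    calc C * ρ ^ 2 * (sideLength ρ N / 2 ^ k) ^ 6 = C * (ρ ^ 2 * (sideLength ρ N / 2 ^ k) ^ 6) := by ring
      _ ≤ C * (2 ^ (6 * (m + 1)) / ρ) := mul_le_mul_of_nonneg_left hw hC.le
  calc dip ρ N k c c' Ψ.ψ * Var ρ N k c c' Ψ.ψ
      ≤ (2 * (occ ρ N k c Ψ.ψ + occ ρ N k c' Ψ.ψ)) * ENNReal.ofReal (C * (2 ^ (6 * (m + 1)) / ρ)) :=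
        mul_le_mul' h1 h2
    _ = ENNReal.ofReal (2 * (C * (2 ^ (6 * (m + 1)) / ρ))) * (occ ρ N k c Ψ.ψ + occ ρ N k c' Ψ.ψ) := by
        rw [ENNReal.ofReal_mul (by norm_num : (0 : ℝ) ≤ 2), ENNReal.ofReal_ofNat]
        ring

/-- … in particular for the hard-sphere gas `hardCorePotential a` (LSSY's model case; BEC open). -/
theorem satNearPivot_hardCorePotential {a : ℝ} (ha : 0 < a) :
    ∃ ρ₀ : ℝ, 0 < ρ₀ ∧ ∀ ρ : ℝ, 0 < ρ → ρ < ρ₀ →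
    ∀ m : ℕ, ∃ C : ℝ, 0 < C ∧ ∃ c₀ : ℝ, 0 < c₀ ∧ ∀ᶠ N : ℕ in Filter.atTop, ∃ δ : ENNReal, 0 < δ ∧
      ∀ Ψ : TrialState N (sideLength ρ N), energy (hardCorePotential a) Ψ ≤
          groundStateEnergy (hardCorePotential a) N (sideLength ρ N) + δ →
        ENNReal.ofReal (c₀ * N) ≤ maxOccupation N Ψ.ψ ∨
          ∀ K k : ℕ, 1 / Real.sqrt ρ ≤ sideLength ρ N / 2 ^ K → sideLength ρ N / 2 ^ K < 2 * (1 / Real.sqrt ρ) →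
            1 ≤ k → k ≤ K → K ≤ k + m →
            ∀ c c' : SubIdx (2 ^ k), c ≠ c' → Sib c c' → IntP k c →
              dip ρ N k c c' Ψ.ψ * Var ρ N k c c' Ψ.ψ ≤ ENNReal.ofReal C * (occ ρ N k c Ψ.ψ + occ ρ N k c' Ψ.ψ) :=
  satNearPivot_of_hardCore ha (isRepulsiveFiniteRange_hardCorePotential a) (fun _ hr => hardCorePotential_of_lt hr)

end Summit.AtomisticToContinuum.BoseEinsteinCondensation.Theorems.NumberPhaseSandwichHardCoreSat

end
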